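import Mathlib

/-!
# Two counting lemmas behind the legal A-sum theorem of a block group (blind cell PercRepro2,
p3 g22, 2026-08-28)

The combinatorial skeleton of `proofs/P3-CPNC.md` §19d: inside a `G − d` block group with `d`
on the A-side, the sum over the legal points of `σ_pq · σ_rs` is `≤ 0` fibre by fibre over
`d`'s pocket Y-cluster.  The two steps of that proof are:

* an **involution step** (`sum_sub_nonpos_of_involution`): on a finite set `s` carrying an
  involution `ψ` with `Y x ≤ W (ψ x)` (a `p–q` Y-path at `x` becomes a W-path at `ψ x`), the
  sum of `Y − W` over `s` is `≤ 0`; for `0/1`-valued `Y, W` this reads «`ψ` injects the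
  points with `(Y, W) = (1, 0)` into those with `(Y, W) = (0, 1)`»
  (`card_filter_le_of_involution`);
* a **face-pairing step** (`sum_mul_sign_nonpos_of_faces`): if a weight `σ` is `1` on a
  «bottom» face, `−1` on a «top» face and `0` elsewhere, and a bijection `φ` from bottom to
  top does not decrease `f`, then `∑ f · σ ≤ 0`.

Both are elementary; they are stated once so that the graph-theoretic instantiations
(`ψ` = «switch the free blocks not adjacent to the pocket cluster and flip the pocket edges
outside it», `φ` = «switch the connector blocks») can be landed as separate lemmas.
Own work, one seat.
-/

namespace Summit.Ventures.PercRepro2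

namespace M9Fibre

open Finset

variable {ι : Type*}

/-- **Involution step.** If `ψ` maps `s` to itself, is an involution on `s`, and
`Y x ≤ W (ψ x)` for every `x ∈ s`, then `∑_{x ∈ s} (Y x − W x) ≤ 0`. -/
theorem sum_sub_nonpos_of_involution {s : Finset ι} {ψ : ι → ι}
    (hmem : ∀ ⦃x⦄, x ∈ s → ψ x ∈ s) (hinv : ∀ ⦃x⦄, x ∈ s → ψ (ψ x) = x)
    {Y W : ι → ℤ} (hYW : ∀ ⦃x⦄, x ∈ s → Y x ≤ W (ψ x)) :
    ∑ x ∈ s, (Y x - W x) ≤ 0 := by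
  have hW : ∑ x ∈ s, W (ψ x) = ∑ x ∈ s, W x :=
    Finset.sum_nbij' ψ ψ (fun x hx => hmem hx) (fun x hx => hmem hx)
      (fun x hx => hinv hx) (fun x hx => hinv hx) (fun x _ => rfl)
  have hY : ∑ x ∈ s, Y x ≤ ∑ x ∈ s, W (ψ x) := Finset.sum_le_sum fun x hx => hYW hx
  rw [Finset.sum_sub_distrib]
  linarith

/-- The `0/1` reading of the involution step: the points of `s` with `Y = 1, W = 0` are at
most as many as those with `Y = 0, W = 1` (the lost points of §19d). -/
theorem card_filter_le_of_involution {s : Finset ι} {ψ : ι → ι}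
    (hmem : ∀ ⦃x⦄, x ∈ s → ψ x ∈ s) (hinv : ∀ ⦃x⦄, x ∈ s → ψ (ψ x) = x)
    {Y W : ι → ℤ} (hY01 : ∀ x, Y x = 0 ∨ Y x = 1) (hW01 : ∀ x, W x = 0 ∨ W x = 1)
    (hYW : ∀ ⦃x⦄, x ∈ s → Y x ≤ W (ψ x)) :
    (s.filter fun x => Y x = 1 ∧ W x = 0).card ≤ (s.filter fun x => Y x = 0 ∧ W x = 1).card := by
  have h := sum_sub_nonpos_of_involution hmem hinv hYW
  -- `Y x − W x` is the indicator of `(1,0)` minus the indicator of `(0,1)`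
  have hpt : ∀ x, Y x - W x = (if Y x = 1 ∧ W x = 0 then (1 : ℤ) else 0)
      - (if Y x = 0 ∧ W x = 1 then (1 : ℤ) else 0) := by
    intro x
    rcases hY01 x with hy | hy <;> rcases hW01 x with hw | hw <;> simp [hy, hw]
  rw [Finset.sum_congr rfl (fun x _ => hpt x), Finset.sum_sub_distrib,
    Finset.sum_boole, Finset.sum_boole] at h
  have := sub_nonpos.1 h
  exact_mod_cast this

/-- **Face-pairing step.** `σ` is `1` on `bottom`, `−1` on `top` and `0` on the rest of `s`
(`bottom`, `top ⊆ s` disjoint); `φ` is a bijection from `bottom` onto `top` (with inverse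
`φ'`) along which `f` does not decrease.  Then `∑_{x ∈ s} f x · σ x ≤ 0`. -/
theorem sum_mul_sign_nonpos_of_faces {s bottom top : Finset ι}
    (hb : bottom ⊆ s) (ht : top ⊆ s) (hdisj : Disjoint bottom top)
    {σ : ι → ℤ} (hσb : ∀ ⦃x⦄, x ∈ bottom → σ x = 1) (hσt : ∀ ⦃x⦄, x ∈ top → σ x = -1)
    (hσ0 : ∀ ⦃x⦄, x ∈ s → x ∉ bottom → x ∉ top → σ x = 0)
    {φ φ' : ι → ι} (hφ : ∀ ⦃x⦄, x ∈ bottom → φ x ∈ top) (hφ' : ∀ ⦃x⦄, x ∈ top → φ' x ∈ bottom)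
    (hl : ∀ ⦃x⦄, x ∈ bottom → φ' (φ x) = x) (hr : ∀ ⦃x⦄, x ∈ top → φ (φ' x) = x)
    {f : ι → ℤ} (hf : ∀ ⦃x⦄, x ∈ bottom → f x ≤ f (φ x)) :
    ∑ x ∈ s, f x * σ x ≤ 0 := by
  classical
  -- split `s` into bottom, top and the rest
  have hsplit : s = bottom ∪ (top ∪ (s \ (bottom ∪ top))) := by
    ext x
    simp only [Finset.mem_union, Finset.mem_sdiff]
    constructor
    · intro hx
      by_cases h1 : x ∈ bottom
      · exact Or.inl h1
      · by_cases h2 : x ∈ top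
        · exact Or.inr (Or.inl h2)
        · exact Or.inr (Or.inr ⟨hx, fun h => h.elim h1 h2⟩)
    · rintro (h | h | ⟨h, _⟩)
      · exact hb h
      · exact ht h
      · exact h
  have hd1 : Disjoint bottom (top ∪ (s \ (bottom ∪ top))) := by
    rw [Finset.disjoint_union_right]
    refine ⟨hdisj, Finset.disjoint_left.2 fun x hx hx' => ?_⟩
    rw [Finset.mem_sdiff, Finset.mem_union] at hx'
    exact hx'.2 (Or.inl hx)
  have hd2 : Disjoint top (s \ (bottom ∪ top)) := by
    refine Finset.disjoint_left.2 fun x hx hx' => ?_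
    rw [Finset.mem_sdiff, Finset.mem_union] at hx'
    exact hx'.2 (Or.inr hx)
  rw [hsplit, Finset.sum_union hd1, Finset.sum_union hd2]
  have hrest : ∑ x ∈ s \ (bottom ∪ top), f x * σ x = 0 := by
    refine Finset.sum_eq_zero fun x hx => ?_
    rw [Finset.mem_sdiff, Finset.mem_union, not_or] at hx
    rw [hσ0 hx.1 hx.2.1 hx.2.2, mul_zero]
  have hbot : ∑ x ∈ bottom, f x * σ x = ∑ x ∈ bottom, f x :=
    Finset.sum_congr rfl fun x hx => by rw [hσb hx, mul_one]
  have htop : ∑ x ∈ top, f x * σ x = ∑ y ∈ bottom, -f (φ y) :=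
    Finset.sum_nbij' φ' φ (fun a ha => hφ' ha) (fun a ha => hφ ha)
      (fun a ha => hr ha) (fun a ha => hl ha)
      (fun a ha => by rw [hσt ha, mul_neg_one, hr ha])
  have hle : ∑ x ∈ bottom, f x ≤ ∑ x ∈ bottom, f (φ x) := Finset.sum_le_sum fun x hx => hf hx
  rw [hrest, hbot, htop, Finset.sum_neg_distrib]
  linarith

end M9Fibre

end Summit.Ventures.PercRepro2
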